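import Summits.BirchSwinnertonDyer.BirchSwinnertonDyer.Theorems.EisensteinPrimesMazurMCOnCellBTwistbackConnectedPartnerZigzag
import Summits.BirchSwinnertonDyer.Rank1Residual.X2.ClassClosureEntireFree
import HarnessLib

/-!
# Crux 3 `MazurMCOnCellB` (stmt-BirchSwinnertonDyer-19033), line `twistback` v12 — PARTNERED-VERTEX CLASS DATA: the right
# disjunct of the registered stub 6⁷ («a PARTNERED VERTEX connected to the class of `W`») and 6⁷'s whole conclusion
# («connected Ш-unit class ∨ connected partnered vertex») are class data at the start, need no start member, and are
# CONSTANT ON ZIG-ZAG COMPONENTS — in both directions through X2b vertices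

Width seat bsd-line-x2-p1-w3 (gen 16), cell `bsd-eis`, 2026-08-28; lane F2g (sequel of this seat's F2d p674224
`…TwistbackZigzagClassData` (Ш-unit datum, v10) and of the LEAD's p678299 `…TwistbackOrderOneAnchorClassData` (anchor datum,
v11)): the same bookkeeping for the datum the LEAD's twistback v12 registers — VERBATIM the binder `hV` of p679233 §1
`bsdp_of_cellB_of_connectedPartner` and VERBATIM the conclusion of `stub_offSubrow_connectedShaUnitOrPartner` (6⁷).
`--supports stmt-BirchSwinnertonDyer-19033 --as helper`. HONEST FRAMING: THEOREMS ONLY (no `def`, no named fact introduced,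
no `sorry`); conditional on modularity (`nonempty_modularParametrizationData`, for conductors of isogenous curves and the
X2b transport) where marked and fact-free otherwise; closes no registered stub; proves NO supply (that every component HAS a
Ш-unit class or a partnered vertex is the registered open content, open in print); no summit statement, no Mazur main
conjecture and no case of BSD is proved for any curve; 0 cells / labels / stubs / tiers move.

## What

The PARTNERED-VERTEX DATUM at `(W, p)` (inline, no `def`): `∃ W₁ ∼ W`, a zig-zag `W₁ ⇝ U` (v10 relation: forward certified
two-steps `TwoStepAt p`, backward ones carrying the X2b assertion of their target), `U ∼ W₀` (all globally minimal), and ONE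
good partner AT `W₀` — `K` imaginary quadratic, Heegner for `N_{W₀}` and `p`, `d_K` odd `< −4`, `ord_{s=1} L(E₀^{(d_K)}, s) = 1`,
`MissingUpperBoundAt Wd p` at every globally minimal model `Wd` of `E₀^{(d_K)}`.

* §1 `exists_connectedPartner_of_isIsogenous` — a CLASS datum at the start (fact-free; the `iff` is two applications);
  `exists_connectedPartner_iff` — the start member `W₁` is redundant (`hmodN`; p674224 §2 `exists_zigzag_of_isIsogenous`);
  `exists_connectedPartner_of_zigzag` — CONSTANT ON COMPONENTS: `W ⇝ U` and the datum at `U` give the datum at `W` (`hmodN`);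
  `exists_connectedPartner_of_zigzag_of_cellB` — and through an X2b vertex the zig-zag may point the other way: `(U, p)` X2b,
  `U ⇝ W`, datum at `U` ⟹ datum at `W` (p674224 `zigzag_reverse_of_cellB`; `hmodN`). The far-end isogeny `U ∼ W₀` is part
  of the datum, so a partner at ANY member of the far class is absorbed by `IsIsogenous.trans'`; the partner package itself
  (whose `MissingUpperBoundAt` clause is not known to be isogeny-invariant) is never transported.
* §2 the same three transports for 6⁷'s CONCLUSION «Ш-unit datum ∨ partnered-vertex datum» (`Or.imp` of p674224 §3 and §1):
  `connectedShaUnit_or_connectedPartner_of_isIsogenous` (fact-free), `…_of_zigzag`, `…_of_zigzag_of_cellB` (`hmodN`). So the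
  conclusion of the v12 stub holds at an X2b pair iff it holds at ANY vertex of its component of the class graph: one
  display (a Ш-unit end, an order-one anchor, a sub-row member, a partner) anywhere in a component settles 6⁷ on all of it.

References: tree p667979, p672105, p671590, p674224, p678299, p679233; LEAD g15 v12 announce (HOME STATUS 2026-08-28
T23:50:31Z); [CremonaAlgorithms1997] §3.9; [Knapp1993] Thm. 11.67; [GreenbergVatsal2000] Thm. (1.3), §2; [MilneADT2006] I.7.3.
-/

set_option autoImplicit false
set_option linter.dupNamespace false -- `Summit.BirchSwinnertonDyer.BirchSwinnertonDyer.…`: summit = sub-problem name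

noncomputable section

open scoped Classical

open WeierstrassCurve NumberField
  Literature.NumberTheory.EllipticCurves
  Literature.NumberTheory.EllipticCurves.ModularForms
  Literature.NumberTheory.QuadraticFields
  Literature.NumberTheory.EllipticCurves.Rank1Residual
  Literature.NumberTheory.EllipticCurves.Rank1Residual.Typed
  Summit.BirchSwinnertonDyer.Rank1Residual
  Summit.BirchSwinnertonDyer.Rank1Residual.X2
  Summit.BirchSwinnertonDyer.BirchSwinnertonDyer.Theorems.EisensteinPrimesMazurMCOnCellBTwistbackTwoStepDefs
  Summit.BirchSwinnertonDyer.BirchSwinnertonDyer.Theorems.EisensteinPrimesMazurMCOnCellBTwistbackZigzagClassData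

namespace Summit.BirchSwinnertonDyer.BirchSwinnertonDyer.Theorems.EisensteinPrimesMazurMCOnCellBTwistbackConnectedPartnerClassData

/-! ## §1. The partnered-vertex datum: class datum at the start, no start member, constant on zig-zag components -/

/-- **The partnered-vertex datum is a union of `ℚ`-isogeny classes** (fact-free, transitivity of `IsIsogenous` at the
start): if `W′ ∼ W` and the datum holds at `W`, it holds at `W′` with the same `W₁`, zig-zag, far class and partner.
[folklore] -/
theorem exists_connectedPartner_of_isIsogenous {p : ℕ} [Fact p.Prime] {W W' : WeierstrassCurve ℚ}
    (hWW' : IsIsogenous W' W)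
    (h : ∃ (W₁ : WeierstrassCurve ℚ) (_ : W₁.IsElliptic) (_ : W₁.IsGloballyMinimal)
        (U : WeierstrassCurve ℚ) (_ : U.IsElliptic) (_ : U.IsGloballyMinimal)
        (W₀ : WeierstrassCurve ℚ) (_ : W₀.IsElliptic) (_ : W₀.IsGloballyMinimal),
        IsIsogenous W W₁ ∧
        Relation.ReflTransGen (fun A B : WeierstrassCurve ℚ ↦ TwoStepAt p A B ∨
          (TwoStepAt p B A ∧ ∃ (_ : B.IsElliptic) (_ : B.IsGloballyMinimal), X2.CellB B p)) W₁ U ∧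
        IsIsogenous U W₀ ∧
        ∃ (K : Type) (_ : Field K) (_ : NumberField K), IsImaginaryQuadratic K ∧
          SatisfiesHeegnerHypothesis (W₀.conductorNorm ℤ) K ∧ SatisfiesHeegnerHypothesis p K ∧
          Odd (NumberField.discr K) ∧ NumberField.discr K < -4 ∧
          (W₀.quadraticTwist (NumberField.discr K : ℚ)).analyticRank = 1 ∧
          ∀ (Wd : WeierstrassCurve ℚ) [Wd.IsElliptic] [Wd.IsGloballyMinimal],
            (∃ C : VariableChange ℚ, C • Wd = W₀.quadraticTwist (NumberField.discr K : ℚ)) →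
            MissingUpperBoundAt Wd p) :
    ∃ (W₁ : WeierstrassCurve ℚ) (_ : W₁.IsElliptic) (_ : W₁.IsGloballyMinimal)
      (U : WeierstrassCurve ℚ) (_ : U.IsElliptic) (_ : U.IsGloballyMinimal)
      (W₀ : WeierstrassCurve ℚ) (_ : W₀.IsElliptic) (_ : W₀.IsGloballyMinimal),
      IsIsogenous W' W₁ ∧
      Relation.ReflTransGen (fun A B : WeierstrassCurve ℚ ↦ TwoStepAt p A B ∨
        (TwoStepAt p B A ∧ ∃ (_ : B.IsElliptic) (_ : B.IsGloballyMinimal), X2.CellB B p)) W₁ U ∧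
      IsIsogenous U W₀ ∧
      ∃ (K : Type) (_ : Field K) (_ : NumberField K), IsImaginaryQuadratic K ∧
        SatisfiesHeegnerHypothesis (W₀.conductorNorm ℤ) K ∧ SatisfiesHeegnerHypothesis p K ∧
        Odd (NumberField.discr K) ∧ NumberField.discr K < -4 ∧
        (W₀.quadraticTwist (NumberField.discr K : ℚ)).analyticRank = 1 ∧
        ∀ (Wd : WeierstrassCurve ℚ) [Wd.IsElliptic] [Wd.IsGloballyMinimal],
          (∃ C : VariableChange ℚ, C • Wd = W₀.quadraticTwist (NumberField.discr K : ℚ)) →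
          MissingUpperBoundAt Wd p := by
  obtain ⟨W₁, _, _, U, _, _, W₀, _, _, h₁, hz, hU, hK⟩ := h
  exact ⟨W₁, inferInstance, inferInstance, U, inferInstance, inferInstance, W₀, inferInstance, inferInstance,
    hWW'.trans' h₁, hz, hU, hK⟩

/-- **The start member `W₁` of the partnered-vertex datum is redundant** (granted modularity, for the conductor): at a
globally minimal elliptic `W` the datum holds iff «`∃ U W₀`, `W ⇝ U` along zig-zags, `U ∼ W₀`, a partner at `W₀`» (`→`:
p674224 §2 `exists_zigzag_of_isIsogenous` pushes `W ∼ W₁` through the zig-zag and `IsIsogenous.trans'` absorbs the shadow's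
far isogeny; `←`: `W₁ := W`). The left side is VERBATIM the right disjunct of twistback v12's
`stub_offSubrow_connectedShaUnitOrPartner`. Conditional on `hmodN` only. [folklore] [cite: GreenbergVatsal2000, Thm. (1.3) and §2 p. 28] -/
theorem exists_connectedPartner_iff (hmodN : nonempty_modularParametrizationData)
    {p : ℕ} [Fact p.Prime] (W : WeierstrassCurve ℚ) [W.IsElliptic] [W.IsGloballyMinimal] :
    (∃ (W₁ : WeierstrassCurve ℚ) (_ : W₁.IsElliptic) (_ : W₁.IsGloballyMinimal)
        (U : WeierstrassCurve ℚ) (_ : U.IsElliptic) (_ : U.IsGloballyMinimal)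
        (W₀ : WeierstrassCurve ℚ) (_ : W₀.IsElliptic) (_ : W₀.IsGloballyMinimal),
        IsIsogenous W W₁ ∧
        Relation.ReflTransGen (fun A B : WeierstrassCurve ℚ ↦ TwoStepAt p A B ∨
          (TwoStepAt p B A ∧ ∃ (_ : B.IsElliptic) (_ : B.IsGloballyMinimal), X2.CellB B p)) W₁ U ∧
        IsIsogenous U W₀ ∧
        ∃ (K : Type) (_ : Field K) (_ : NumberField K), IsImaginaryQuadratic K ∧
          SatisfiesHeegnerHypothesis (W₀.conductorNorm ℤ) K ∧ SatisfiesHeegnerHypothesis p K ∧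
          Odd (NumberField.discr K) ∧ NumberField.discr K < -4 ∧
          (W₀.quadraticTwist (NumberField.discr K : ℚ)).analyticRank = 1 ∧
          ∀ (Wd : WeierstrassCurve ℚ) [Wd.IsElliptic] [Wd.IsGloballyMinimal],
            (∃ C : VariableChange ℚ, C • Wd = W₀.quadraticTwist (NumberField.discr K : ℚ)) →
            MissingUpperBoundAt Wd p) ↔
    (∃ (U : WeierstrassCurve ℚ) (_ : U.IsElliptic) (_ : U.IsGloballyMinimal)
        (W₀ : WeierstrassCurve ℚ) (_ : W₀.IsElliptic) (_ : W₀.IsGloballyMinimal),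
        Relation.ReflTransGen (fun A B : WeierstrassCurve ℚ ↦ TwoStepAt p A B ∨
          (TwoStepAt p B A ∧ ∃ (_ : B.IsElliptic) (_ : B.IsGloballyMinimal), X2.CellB B p)) W U ∧
        IsIsogenous U W₀ ∧
        ∃ (K : Type) (_ : Field K) (_ : NumberField K), IsImaginaryQuadratic K ∧
          SatisfiesHeegnerHypothesis (W₀.conductorNorm ℤ) K ∧ SatisfiesHeegnerHypothesis p K ∧
          Odd (NumberField.discr K) ∧ NumberField.discr K < -4 ∧
          (W₀.quadraticTwist (NumberField.discr K : ℚ)).analyticRank = 1 ∧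
          ∀ (Wd : WeierstrassCurve ℚ) [Wd.IsElliptic] [Wd.IsGloballyMinimal],
            (∃ C : VariableChange ℚ, C • Wd = W₀.quadraticTwist (NumberField.discr K : ℚ)) →
            MissingUpperBoundAt Wd p) := by
  constructor
  · rintro ⟨W₁, _, _, U, _, _, W₀, _, _, h₁, hz, hU, hK⟩
    obtain ⟨U₂, _, _, hU₂, hiso₂⟩ := exists_zigzag_of_isIsogenous hmodN h₁ hz
    exact ⟨U₂, inferInstance, inferInstance, W₀, inferInstance, inferInstance, hU₂, hiso₂.trans' hU, hK⟩
  · rintro ⟨U, _, _, W₀, _, _, hz, hU, hK⟩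
    exact ⟨W, inferInstance, inferInstance, U, inferInstance, inferInstance, W₀, inferInstance, inferInstance,
      isIsogenous_self W, hz, hU, hK⟩

/-- **The partnered-vertex datum is CONSTANT ON ZIG-ZAG COMPONENTS**: if `W ⇝ U` along zig-zags (`W`, `U` globally
minimal) and the datum holds at `U` (`U ∼ U₁ ⇝ U' ∼ W₀`, partner at `W₀`), then it holds at `W` — push `U ∼ U₁` through
`U₁`'s zig-zag (p674224 §2), concatenate (`Relation.ReflTransGen.trans`), absorb the shadow's far isogeny into `∼ W₀`, take
`W₁ := W`. So the population on which 6⁷'s right disjunct holds is a union of connected components of the class graph.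
Conditional on `hmodN` only. [folklore] [cite: GreenbergVatsal2000, Thm. (1.3) and §2 p. 28] -/
theorem exists_connectedPartner_of_zigzag (hmodN : nonempty_modularParametrizationData)
    {p : ℕ} [Fact p.Prime] {W : WeierstrassCurve ℚ} [W.IsElliptic] [W.IsGloballyMinimal]
    (U : WeierstrassCurve ℚ) [U.IsElliptic] [U.IsGloballyMinimal]
    (hz : Relation.ReflTransGen (fun A B : WeierstrassCurve ℚ ↦ TwoStepAt p A B ∨
      (TwoStepAt p B A ∧ ∃ (_ : B.IsElliptic) (_ : B.IsGloballyMinimal), X2.CellB B p)) W U)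
    (hU : ∃ (U₁ : WeierstrassCurve ℚ) (_ : U₁.IsElliptic) (_ : U₁.IsGloballyMinimal)
        (U' : WeierstrassCurve ℚ) (_ : U'.IsElliptic) (_ : U'.IsGloballyMinimal)
        (W₀ : WeierstrassCurve ℚ) (_ : W₀.IsElliptic) (_ : W₀.IsGloballyMinimal),
        IsIsogenous U U₁ ∧
        Relation.ReflTransGen (fun A B : WeierstrassCurve ℚ ↦ TwoStepAt p A B ∨
          (TwoStepAt p B A ∧ ∃ (_ : B.IsElliptic) (_ : B.IsGloballyMinimal), X2.CellB B p)) U₁ U' ∧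
        IsIsogenous U' W₀ ∧
        ∃ (K : Type) (_ : Field K) (_ : NumberField K), IsImaginaryQuadratic K ∧
          SatisfiesHeegnerHypothesis (W₀.conductorNorm ℤ) K ∧ SatisfiesHeegnerHypothesis p K ∧
          Odd (NumberField.discr K) ∧ NumberField.discr K < -4 ∧
          (W₀.quadraticTwist (NumberField.discr K : ℚ)).analyticRank = 1 ∧
          ∀ (Wd : WeierstrassCurve ℚ) [Wd.IsElliptic] [Wd.IsGloballyMinimal],
            (∃ C : VariableChange ℚ, C • Wd = W₀.quadraticTwist (NumberField.discr K : ℚ)) →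
            MissingUpperBoundAt Wd p) :
    ∃ (W₁ : WeierstrassCurve ℚ) (_ : W₁.IsElliptic) (_ : W₁.IsGloballyMinimal)
      (U : WeierstrassCurve ℚ) (_ : U.IsElliptic) (_ : U.IsGloballyMinimal)
      (W₀ : WeierstrassCurve ℚ) (_ : W₀.IsElliptic) (_ : W₀.IsGloballyMinimal),
      IsIsogenous W W₁ ∧
      Relation.ReflTransGen (fun A B : WeierstrassCurve ℚ ↦ TwoStepAt p A B ∨
        (TwoStepAt p B A ∧ ∃ (_ : B.IsElliptic) (_ : B.IsGloballyMinimal), X2.CellB B p)) W₁ U ∧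
      IsIsogenous U W₀ ∧
      ∃ (K : Type) (_ : Field K) (_ : NumberField K), IsImaginaryQuadratic K ∧
        SatisfiesHeegnerHypothesis (W₀.conductorNorm ℤ) K ∧ SatisfiesHeegnerHypothesis p K ∧
        Odd (NumberField.discr K) ∧ NumberField.discr K < -4 ∧
        (W₀.quadraticTwist (NumberField.discr K : ℚ)).analyticRank = 1 ∧
        ∀ (Wd : WeierstrassCurve ℚ) [Wd.IsElliptic] [Wd.IsGloballyMinimal],
          (∃ C : VariableChange ℚ, C • Wd = W₀.quadraticTwist (NumberField.discr K : ℚ)) →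
          MissingUpperBoundAt Wd p := by
  obtain ⟨U₁, _, _, U', _, _, W₀, _, _, h₁, hzU, hU', hK⟩ := hU
  obtain ⟨U₂, _, _, hU₂, hiso₂⟩ := exists_zigzag_of_isIsogenous hmodN h₁ hzU
  exact ⟨W, inferInstance, inferInstance, U₂, inferInstance, inferInstance, W₀, inferInstance, inferInstance,
    isIsogenous_self W, hz.trans hU₂, hiso₂.trans' hU', hK⟩

/-- **Through an X2b vertex the zig-zag may point the other way**: if `(U, p)` is X2b, `U ⇝ W` along zig-zags (`U`, `W`
globally minimal) and the partnered-vertex datum holds at `U`, then it holds at `W` — p674224 `zigzag_reverse_of_cellB`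
walks the zig-zag back (`W ⇝ U`; modularity, here from `hmodN` by
`X2.ClassClosureEntireFree.hasEntireLFunction_rat_of_nonempty_modularParametrizationData`) and
`exists_connectedPartner_of_zigzag` concludes. The form an explicit display consumes: a partner certified at one vertex
`U` of a component places every vertex its zig-zags reach. Conditional on `hmodN` only. [folklore] -/
theorem exists_connectedPartner_of_zigzag_of_cellB (hmodN : nonempty_modularParametrizationData)
    {p : ℕ} [Fact p.Prime] {U : WeierstrassCurve ℚ} [U.IsElliptic] [U.IsGloballyMinimal] (hcU : X2.CellB U p)
    (W : WeierstrassCurve ℚ) [W.IsElliptic] [W.IsGloballyMinimal]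
    (hz : Relation.ReflTransGen (fun A B : WeierstrassCurve ℚ ↦ TwoStepAt p A B ∨
      (TwoStepAt p B A ∧ ∃ (_ : B.IsElliptic) (_ : B.IsGloballyMinimal), X2.CellB B p)) U W)
    (hU : ∃ (U₁ : WeierstrassCurve ℚ) (_ : U₁.IsElliptic) (_ : U₁.IsGloballyMinimal)
        (U' : WeierstrassCurve ℚ) (_ : U'.IsElliptic) (_ : U'.IsGloballyMinimal)
        (W₀ : WeierstrassCurve ℚ) (_ : W₀.IsElliptic) (_ : W₀.IsGloballyMinimal),
        IsIsogenous U U₁ ∧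
        Relation.ReflTransGen (fun A B : WeierstrassCurve ℚ ↦ TwoStepAt p A B ∨
          (TwoStepAt p B A ∧ ∃ (_ : B.IsElliptic) (_ : B.IsGloballyMinimal), X2.CellB B p)) U₁ U' ∧
        IsIsogenous U' W₀ ∧
        ∃ (K : Type) (_ : Field K) (_ : NumberField K), IsImaginaryQuadratic K ∧
          SatisfiesHeegnerHypothesis (W₀.conductorNorm ℤ) K ∧ SatisfiesHeegnerHypothesis p K ∧
          Odd (NumberField.discr K) ∧ NumberField.discr K < -4 ∧
          (W₀.quadraticTwist (NumberField.discr K : ℚ)).analyticRank = 1 ∧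
          ∀ (Wd : WeierstrassCurve ℚ) [Wd.IsElliptic] [Wd.IsGloballyMinimal],
            (∃ C : VariableChange ℚ, C • Wd = W₀.quadraticTwist (NumberField.discr K : ℚ)) →
            MissingUpperBoundAt Wd p) :
    ∃ (W₁ : WeierstrassCurve ℚ) (_ : W₁.IsElliptic) (_ : W₁.IsGloballyMinimal)
      (U : WeierstrassCurve ℚ) (_ : U.IsElliptic) (_ : U.IsGloballyMinimal)
      (W₀ : WeierstrassCurve ℚ) (_ : W₀.IsElliptic) (_ : W₀.IsGloballyMinimal),
      IsIsogenous W W₁ ∧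
      Relation.ReflTransGen (fun A B : WeierstrassCurve ℚ ↦ TwoStepAt p A B ∨
        (TwoStepAt p B A ∧ ∃ (_ : B.IsElliptic) (_ : B.IsGloballyMinimal), X2.CellB B p)) W₁ U ∧
      IsIsogenous U W₀ ∧
      ∃ (K : Type) (_ : Field K) (_ : NumberField K), IsImaginaryQuadratic K ∧
        SatisfiesHeegnerHypothesis (W₀.conductorNorm ℤ) K ∧ SatisfiesHeegnerHypothesis p K ∧
        Odd (NumberField.discr K) ∧ NumberField.discr K < -4 ∧
        (W₀.quadraticTwist (NumberField.discr K : ℚ)).analyticRank = 1 ∧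
        ∀ (Wd : WeierstrassCurve ℚ) [Wd.IsElliptic] [Wd.IsGloballyMinimal],
          (∃ C : VariableChange ℚ, C • Wd = W₀.quadraticTwist (NumberField.discr K : ℚ)) →
          MissingUpperBoundAt Wd p :=
  exists_connectedPartner_of_zigzag hmodN U
    (zigzag_reverse_of_cellB (X2.ClassClosureEntireFree.hasEntireLFunction_rat_of_nonempty_modularParametrizationData hmodN)
      hcU hz) hU

/-! ## §2. The conclusion of 6⁷ «connected Ш-unit class ∨ connected partnered vertex»: the same three transports -/

/-- **6⁷'s conclusion is a union of `ℚ`-isogeny classes** (fact-free): `Or.imp` of p674224 §3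
`exists_connectedClassShaUnit_of_isIsogenous` and §1 `exists_connectedPartner_of_isIsogenous`. The disjunction is VERBATIM
the conclusion of twistback v12's `stub_offSubrow_connectedShaUnitOrPartner` at `W` (hypothesis) and at `W′` (goal). [folklore] -/
theorem connectedShaUnit_or_connectedPartner_of_isIsogenous {p : ℕ} [Fact p.Prime] {W W' : WeierstrassCurve ℚ}
    (hWW' : IsIsogenous W' W)
    (h : (∃ (W₁ : WeierstrassCurve ℚ) (_ : W₁.IsElliptic) (_ : W₁.IsGloballyMinimal)
          (W'' : WeierstrassCurve ℚ) (_ : W''.IsElliptic) (_ : W''.IsGloballyMinimal)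
          (Wc : WeierstrassCurve ℚ) (_ : Wc.IsElliptic) (_ : Wc.IsGloballyMinimal),
          IsIsogenous W W₁ ∧
          Relation.ReflTransGen (fun A B : WeierstrassCurve ℚ ↦ TwoStepAt p A B ∨
            (TwoStepAt p B A ∧ ∃ (_ : B.IsElliptic) (_ : B.IsGloballyMinimal), X2.CellB B p)) W₁ W'' ∧
          IsIsogenous W'' Wc ∧
          ∃ q : ℚ, shaAn Wc = (q : ℂ) ∧ padicValRat p q = 0) ∨
      (∃ (W₁ : WeierstrassCurve ℚ) (_ : W₁.IsElliptic) (_ : W₁.IsGloballyMinimal)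
          (U : WeierstrassCurve ℚ) (_ : U.IsElliptic) (_ : U.IsGloballyMinimal)
          (W₀ : WeierstrassCurve ℚ) (_ : W₀.IsElliptic) (_ : W₀.IsGloballyMinimal),
          IsIsogenous W W₁ ∧
          Relation.ReflTransGen (fun A B : WeierstrassCurve ℚ ↦ TwoStepAt p A B ∨
            (TwoStepAt p B A ∧ ∃ (_ : B.IsElliptic) (_ : B.IsGloballyMinimal), X2.CellB B p)) W₁ U ∧
          IsIsogenous U W₀ ∧
          ∃ (K : Type) (_ : Field K) (_ : NumberField K), IsImaginaryQuadratic K ∧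
            SatisfiesHeegnerHypothesis (W₀.conductorNorm ℤ) K ∧ SatisfiesHeegnerHypothesis p K ∧
            Odd (NumberField.discr K) ∧ NumberField.discr K < -4 ∧
            (W₀.quadraticTwist (NumberField.discr K : ℚ)).analyticRank = 1 ∧
            ∀ (Wd : WeierstrassCurve ℚ) [Wd.IsElliptic] [Wd.IsGloballyMinimal],
              (∃ C : VariableChange ℚ, C • Wd = W₀.quadraticTwist (NumberField.discr K : ℚ)) →
              MissingUpperBoundAt Wd p)) :
    (∃ (W₁ : WeierstrassCurve ℚ) (_ : W₁.IsElliptic) (_ : W₁.IsGloballyMinimal)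
        (W'' : WeierstrassCurve ℚ) (_ : W''.IsElliptic) (_ : W''.IsGloballyMinimal)
        (Wc : WeierstrassCurve ℚ) (_ : Wc.IsElliptic) (_ : Wc.IsGloballyMinimal),
        IsIsogenous W' W₁ ∧
        Relation.ReflTransGen (fun A B : WeierstrassCurve ℚ ↦ TwoStepAt p A B ∨
          (TwoStepAt p B A ∧ ∃ (_ : B.IsElliptic) (_ : B.IsGloballyMinimal), X2.CellB B p)) W₁ W'' ∧
        IsIsogenous W'' Wc ∧
        ∃ q : ℚ, shaAn Wc = (q : ℂ) ∧ padicValRat p q = 0) ∨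
    (∃ (W₁ : WeierstrassCurve ℚ) (_ : W₁.IsElliptic) (_ : W₁.IsGloballyMinimal)
        (U : WeierstrassCurve ℚ) (_ : U.IsElliptic) (_ : U.IsGloballyMinimal)
        (W₀ : WeierstrassCurve ℚ) (_ : W₀.IsElliptic) (_ : W₀.IsGloballyMinimal),
        IsIsogenous W' W₁ ∧
        Relation.ReflTransGen (fun A B : WeierstrassCurve ℚ ↦ TwoStepAt p A B ∨
          (TwoStepAt p B A ∧ ∃ (_ : B.IsElliptic) (_ : B.IsGloballyMinimal), X2.CellB B p)) W₁ U ∧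
        IsIsogenous U W₀ ∧
        ∃ (K : Type) (_ : Field K) (_ : NumberField K), IsImaginaryQuadratic K ∧
          SatisfiesHeegnerHypothesis (W₀.conductorNorm ℤ) K ∧ SatisfiesHeegnerHypothesis p K ∧
          Odd (NumberField.discr K) ∧ NumberField.discr K < -4 ∧
          (W₀.quadraticTwist (NumberField.discr K : ℚ)).analyticRank = 1 ∧
          ∀ (Wd : WeierstrassCurve ℚ) [Wd.IsElliptic] [Wd.IsGloballyMinimal],
            (∃ C : VariableChange ℚ, C • Wd = W₀.quadraticTwist (NumberField.discr K : ℚ)) →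
            MissingUpperBoundAt Wd p) :=
  h.imp (exists_connectedClassShaUnit_of_isIsogenous hWW') (exists_connectedPartner_of_isIsogenous hWW')

/-- **6⁷'s conclusion is CONSTANT ON ZIG-ZAG COMPONENTS**: if `W ⇝ U` along zig-zags (`W`, `U` globally minimal) and the
disjunction holds at `U`, it holds at `W` (`Or.imp` of p674224 §3 `exists_connectedClassShaUnit_of_zigzag` and §1
`exists_connectedPartner_of_zigzag`). So the registered stub of twistback v12 holds at an X2b pair as soon as its
conclusion is displayed at ANY vertex the pair's zig-zags reach. Conditional on `hmodN` only. [folklore] -/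
theorem connectedShaUnit_or_connectedPartner_of_zigzag (hmodN : nonempty_modularParametrizationData)
    {p : ℕ} [Fact p.Prime] {W : WeierstrassCurve ℚ} [W.IsElliptic] [W.IsGloballyMinimal]
    (U : WeierstrassCurve ℚ) [U.IsElliptic] [U.IsGloballyMinimal]
    (hz : Relation.ReflTransGen (fun A B : WeierstrassCurve ℚ ↦ TwoStepAt p A B ∨
      (TwoStepAt p B A ∧ ∃ (_ : B.IsElliptic) (_ : B.IsGloballyMinimal), X2.CellB B p)) W U)
    (hU : (∃ (U₁ : WeierstrassCurve ℚ) (_ : U₁.IsElliptic) (_ : U₁.IsGloballyMinimal)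
          (U'' : WeierstrassCurve ℚ) (_ : U''.IsElliptic) (_ : U''.IsGloballyMinimal)
          (Uc : WeierstrassCurve ℚ) (_ : Uc.IsElliptic) (_ : Uc.IsGloballyMinimal),
          IsIsogenous U U₁ ∧
          Relation.ReflTransGen (fun A B : WeierstrassCurve ℚ ↦ TwoStepAt p A B ∨
            (TwoStepAt p B A ∧ ∃ (_ : B.IsElliptic) (_ : B.IsGloballyMinimal), X2.CellB B p)) U₁ U'' ∧
          IsIsogenous U'' Uc ∧
          ∃ q : ℚ, shaAn Uc = (q : ℂ) ∧ padicValRat p q = 0) ∨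
      (∃ (U₁ : WeierstrassCurve ℚ) (_ : U₁.IsElliptic) (_ : U₁.IsGloballyMinimal)
          (U' : WeierstrassCurve ℚ) (_ : U'.IsElliptic) (_ : U'.IsGloballyMinimal)
          (W₀ : WeierstrassCurve ℚ) (_ : W₀.IsElliptic) (_ : W₀.IsGloballyMinimal),
          IsIsogenous U U₁ ∧
          Relation.ReflTransGen (fun A B : WeierstrassCurve ℚ ↦ TwoStepAt p A B ∨
            (TwoStepAt p B A ∧ ∃ (_ : B.IsElliptic) (_ : B.IsGloballyMinimal), X2.CellB B p)) U₁ U' ∧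
          IsIsogenous U' W₀ ∧
          ∃ (K : Type) (_ : Field K) (_ : NumberField K), IsImaginaryQuadratic K ∧
            SatisfiesHeegnerHypothesis (W₀.conductorNorm ℤ) K ∧ SatisfiesHeegnerHypothesis p K ∧
            Odd (NumberField.discr K) ∧ NumberField.discr K < -4 ∧
            (W₀.quadraticTwist (NumberField.discr K : ℚ)).analyticRank = 1 ∧
            ∀ (Wd : WeierstrassCurve ℚ) [Wd.IsElliptic] [Wd.IsGloballyMinimal],
              (∃ C : VariableChange ℚ, C • Wd = W₀.quadraticTwist (NumberField.discr K : ℚ)) →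
              MissingUpperBoundAt Wd p)) :
    (∃ (W₁ : WeierstrassCurve ℚ) (_ : W₁.IsElliptic) (_ : W₁.IsGloballyMinimal)
        (W'' : WeierstrassCurve ℚ) (_ : W''.IsElliptic) (_ : W''.IsGloballyMinimal)
        (Wc : WeierstrassCurve ℚ) (_ : Wc.IsElliptic) (_ : Wc.IsGloballyMinimal),
        IsIsogenous W W₁ ∧
        Relation.ReflTransGen (fun A B : WeierstrassCurve ℚ ↦ TwoStepAt p A B ∨
          (TwoStepAt p B A ∧ ∃ (_ : B.IsElliptic) (_ : B.IsGloballyMinimal), X2.CellB B p)) W₁ W'' ∧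
        IsIsogenous W'' Wc ∧
        ∃ q : ℚ, shaAn Wc = (q : ℂ) ∧ padicValRat p q = 0) ∨
    (∃ (W₁ : WeierstrassCurve ℚ) (_ : W₁.IsElliptic) (_ : W₁.IsGloballyMinimal)
        (U : WeierstrassCurve ℚ) (_ : U.IsElliptic) (_ : U.IsGloballyMinimal)
        (W₀ : WeierstrassCurve ℚ) (_ : W₀.IsElliptic) (_ : W₀.IsGloballyMinimal),
        IsIsogenous W W₁ ∧
        Relation.ReflTransGen (fun A B : WeierstrassCurve ℚ ↦ TwoStepAt p A B ∨
          (TwoStepAt p B A ∧ ∃ (_ : B.IsElliptic) (_ : B.IsGloballyMinimal), X2.CellB B p)) W₁ U ∧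
        IsIsogenous U W₀ ∧
        ∃ (K : Type) (_ : Field K) (_ : NumberField K), IsImaginaryQuadratic K ∧
          SatisfiesHeegnerHypothesis (W₀.conductorNorm ℤ) K ∧ SatisfiesHeegnerHypothesis p K ∧
          Odd (NumberField.discr K) ∧ NumberField.discr K < -4 ∧
          (W₀.quadraticTwist (NumberField.discr K : ℚ)).analyticRank = 1 ∧
          ∀ (Wd : WeierstrassCurve ℚ) [Wd.IsElliptic] [Wd.IsGloballyMinimal],
            (∃ C : VariableChange ℚ, C • Wd = W₀.quadraticTwist (NumberField.discr K : ℚ)) →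
            MissingUpperBoundAt Wd p) :=
  hU.imp (exists_connectedClassShaUnit_of_zigzag hmodN U hz) (exists_connectedPartner_of_zigzag hmodN U hz)

/-- **… and in the other direction through an X2b vertex**: if `(U, p)` is X2b, `U ⇝ W` along zig-zags (`U`, `W` globally
minimal) and the disjunction holds at `U`, it holds at `W` (p674224 `zigzag_reverse_of_cellB`, then
`connectedShaUnit_or_connectedPartner_of_zigzag`). With the previous theorem: on the X2b population the conclusion of 6⁷ is
an invariant of the connected component of the class graph — one display anywhere in a component (a Ш-unit end, an
order-one anchor via p679233 §2, a sub-row member via p679233 §3, a partner at a pair) settles the v12 stub on every X2b pair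
of that component. Conditional on `hmodN` only. [folklore] -/
theorem connectedShaUnit_or_connectedPartner_of_zigzag_of_cellB (hmodN : nonempty_modularParametrizationData)
    {p : ℕ} [Fact p.Prime] {U : WeierstrassCurve ℚ} [U.IsElliptic] [U.IsGloballyMinimal] (hcU : X2.CellB U p)
    (W : WeierstrassCurve ℚ) [W.IsElliptic] [W.IsGloballyMinimal]
    (hz : Relation.ReflTransGen (fun A B : WeierstrassCurve ℚ ↦ TwoStepAt p A B ∨
      (TwoStepAt p B A ∧ ∃ (_ : B.IsElliptic) (_ : B.IsGloballyMinimal), X2.CellB B p)) U W)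
    (hU : (∃ (U₁ : WeierstrassCurve ℚ) (_ : U₁.IsElliptic) (_ : U₁.IsGloballyMinimal)
          (U'' : WeierstrassCurve ℚ) (_ : U''.IsElliptic) (_ : U''.IsGloballyMinimal)
          (Uc : WeierstrassCurve ℚ) (_ : Uc.IsElliptic) (_ : Uc.IsGloballyMinimal),
          IsIsogenous U U₁ ∧
          Relation.ReflTransGen (fun A B : WeierstrassCurve ℚ ↦ TwoStepAt p A B ∨
            (TwoStepAt p B A ∧ ∃ (_ : B.IsElliptic) (_ : B.IsGloballyMinimal), X2.CellB B p)) U₁ U'' ∧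
          IsIsogenous U'' Uc ∧
          ∃ q : ℚ, shaAn Uc = (q : ℂ) ∧ padicValRat p q = 0) ∨
      (∃ (U₁ : WeierstrassCurve ℚ) (_ : U₁.IsElliptic) (_ : U₁.IsGloballyMinimal)
          (U' : WeierstrassCurve ℚ) (_ : U'.IsElliptic) (_ : U'.IsGloballyMinimal)
          (W₀ : WeierstrassCurve ℚ) (_ : W₀.IsElliptic) (_ : W₀.IsGloballyMinimal),
          IsIsogenous U U₁ ∧
          Relation.ReflTransGen (fun A B : WeierstrassCurve ℚ ↦ TwoStepAt p A B ∨
            (TwoStepAt p B A ∧ ∃ (_ : B.IsElliptic) (_ : B.IsGloballyMinimal), X2.CellB B p)) U₁ U' ∧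
          IsIsogenous U' W₀ ∧
          ∃ (K : Type) (_ : Field K) (_ : NumberField K), IsImaginaryQuadratic K ∧
            SatisfiesHeegnerHypothesis (W₀.conductorNorm ℤ) K ∧ SatisfiesHeegnerHypothesis p K ∧
            Odd (NumberField.discr K) ∧ NumberField.discr K < -4 ∧
            (W₀.quadraticTwist (NumberField.discr K : ℚ)).analyticRank = 1 ∧
            ∀ (Wd : WeierstrassCurve ℚ) [Wd.IsElliptic] [Wd.IsGloballyMinimal],
              (∃ C : VariableChange ℚ, C • Wd = W₀.quadraticTwist (NumberField.discr K : ℚ)) →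
              MissingUpperBoundAt Wd p)) :
    (∃ (W₁ : WeierstrassCurve ℚ) (_ : W₁.IsElliptic) (_ : W₁.IsGloballyMinimal)
        (W'' : WeierstrassCurve ℚ) (_ : W''.IsElliptic) (_ : W''.IsGloballyMinimal)
        (Wc : WeierstrassCurve ℚ) (_ : Wc.IsElliptic) (_ : Wc.IsGloballyMinimal),
        IsIsogenous W W₁ ∧
        Relation.ReflTransGen (fun A B : WeierstrassCurve ℚ ↦ TwoStepAt p A B ∨
          (TwoStepAt p B A ∧ ∃ (_ : B.IsElliptic) (_ : B.IsGloballyMinimal), X2.CellB B p)) W₁ W'' ∧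
        IsIsogenous W'' Wc ∧
        ∃ q : ℚ, shaAn Wc = (q : ℂ) ∧ padicValRat p q = 0) ∨
    (∃ (W₁ : WeierstrassCurve ℚ) (_ : W₁.IsElliptic) (_ : W₁.IsGloballyMinimal)
        (U : WeierstrassCurve ℚ) (_ : U.IsElliptic) (_ : U.IsGloballyMinimal)
        (W₀ : WeierstrassCurve ℚ) (_ : W₀.IsElliptic) (_ : W₀.IsGloballyMinimal),
        IsIsogenous W W₁ ∧
        Relation.ReflTransGen (fun A B : WeierstrassCurve ℚ ↦ TwoStepAt p A B ∨
          (TwoStepAt p B A ∧ ∃ (_ : B.IsElliptic) (_ : B.IsGloballyMinimal), X2.CellB B p)) W₁ U ∧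
        IsIsogenous U W₀ ∧
        ∃ (K : Type) (_ : Field K) (_ : NumberField K), IsImaginaryQuadratic K ∧
          SatisfiesHeegnerHypothesis (W₀.conductorNorm ℤ) K ∧ SatisfiesHeegnerHypothesis p K ∧
          Odd (NumberField.discr K) ∧ NumberField.discr K < -4 ∧
          (W₀.quadraticTwist (NumberField.discr K : ℚ)).analyticRank = 1 ∧
          ∀ (Wd : WeierstrassCurve ℚ) [Wd.IsElliptic] [Wd.IsGloballyMinimal],
            (∃ C : VariableChange ℚ, C • Wd = W₀.quadraticTwist (NumberField.discr K : ℚ)) →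
            MissingUpperBoundAt Wd p) :=
  connectedShaUnit_or_connectedPartner_of_zigzag hmodN U
    (zigzag_reverse_of_cellB (X2.ClassClosureEntireFree.hasEntireLFunction_rat_of_nonempty_modularParametrizationData hmodN)
      hcU hz) hU

end Summit.BirchSwinnertonDyer.BirchSwinnertonDyer.Theorems.EisensteinPrimesMazurMCOnCellBTwistbackConnectedPartnerClassData

end
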